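import Summits.AtomisticToContinuum.HydrodynamicLimit.Theorems.LambertianContactSwapContactAngleEquidistributionVelTelescope
import Summits.AtomisticToContinuum.HydrodynamicLimit.Theorems.LambertianContactSwapContactAngleEquidistributionBoostInstants
import Summits.AtomisticToContinuum.HydrodynamicLimit.Theorems.LambertianContactSwapSwapGapEntropyBudgetStatics
import Literature.MathematicalPhysics.KineticTheory.HardSphereTwoTimePressure
import Literature.Analysis.FluidPDE.HardSphereAlexander
import Literature.Analysis.FluidPDE.HardSphereTorusMeasure
import HarnessLib

/-!
# The collision sum rule under every local Gibbs law (line `Sketch` v8, stub `stub_sumRule`)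

Crux `Summit.AtomisticToContinuum.HydrodynamicLimit.Theses.LambertianContactSwap.ContactAngleEquidistribution`
(stmt-AtomisticToContinuum-12097). The crux is a statement about `|g|²`-weighted collision sums over Alexander's
collision-by-collision construction of the hard-sphere flow under the (non-invariant) local Gibbs laws
`P_N = localGibbsLaw σ a₀ u₀ θ₀ N`, in the hydrodynamic scaling (`≍ N^{4/3}` collisions on `[0, t]`). This file
proves the one unconditional statement about such sums OUT of equilibrium that the line has identified: for
every velocity observable `φ_N` of quadratic growth, `|φ_N(v)| ≤ c (1 + |v|²)`, the normalised collision sum of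
the COLLISIONAL CHANGES `Δφ_N = φ_N(vᵢ') + φ_N(vⱼ') − φ_N(vᵢ) − φ_N(vⱼ)` satisfies
`|E_{P_N} (N+1)^{-4/3} Σ_{coll ≤ t} Δφ_N| ≤ C (N+1)^{-1/3}` for all `N`, for EVERY family of continuous profiles,
every `0 < σ < 1/2`, every flow family `Φ` and every `t` — no equilibrium, no chaos hypothesis, no named fact.
Proof: almost every datum is good (Alexander's theorem `torusFlow_ae_good_holds` + absolute continuity of the
local Gibbs law), on good data the sum telescopes to `Σᵢ φ_N(vᵢ(z_K)) − Σᵢ φ_N(vᵢ(z))`, `K = collisionCount z t`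
(`stub_velTelescope`; the counted free flights are finite, `collisionInstant_succ_le_of_mem_range`), which is
bounded by `2c((N+1) + Σᵢ|vᵢ|²)` by energy conservation (`configEnergy_stateAfter`), and
`E_{P_N} Σᵢ|vᵢ|² ≤ C (N+1)` (`exists_lintegral_sum_norm_sq_localGibbsLaw_le`).

* `abs_sum_phi_le` — `|Σᵢ φ(vᵢ)| ≤ c((N+1) + 2 E(z))` for `|φ(v)| ≤ c(1 + |v|²)`;
* `collisionDiffSum_abs_le_of_good` — the PATHWISE bound `|Σ_{coll ≤ t} Δφ| ≤ 2c((N+1) + Σᵢ|vᵢ|²)` on good data;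
* `ae_mem_alexanderGood_localGibbsLaw` — almost every datum of a local Gibbs law is good for Alexander's
  construction at diameter `hsDiameter σ N` (`0 < σ < 1/2`);
* `exists_integrable_sum_norm_sq_localGibbsLaw` — `Σᵢ|vᵢ|²` is `P_N`-integrable with mean `≤ C₂ (N+1)`;
* `stub_sumRule` — the registered stub.

References: folklore (the telescoping is CIP 1994 §4.2 bookkeeping; the moment bound is Kipnis–Landim 1999
App. 1 statics).
-/

noncomputable section

open MeasureTheory Filter Set Topology
open scoped ENNReal BigOperators Classical

namespace Summit.AtomisticToContinuum.HydrodynamicLimit.Theorems.ContactAngleEquidistributionSketch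

open Literature.Analysis.FluidPDE Literature.MathematicalPhysics.KineticTheory

/-- A velocity observable of quadratic growth sums to at most `c((N+1) + 2E)` in absolute value over a
configuration of `N + 1` spheres, `E = ½ Σᵢ |vᵢ|²` its kinetic energy. [folklore] -/
theorem abs_sum_phi_le {N : ℕ} {c : ℝ} {φ : V3 → ℝ} (hφ : ∀ v, |φ v| ≤ c * (1 + ‖v‖ ^ 2))
    (z : Config (N + 1) (Fin 3) T3) :
    |∑ i, φ ((z i).2)| ≤ c * (((N : ℝ) + 1) + 2 * configEnergy z) := by
  calc |∑ i, φ ((z i).2)| ≤ ∑ i, |φ ((z i).2)| := Finset.abs_sum_le_sum_abs _ _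
    _ ≤ ∑ i, c * (1 + ‖(z i).2‖ ^ 2) := Finset.sum_le_sum fun i _ => hφ _
    _ = c * (((N : ℝ) + 1) + 2 * configEnergy z) := by
        rw [← Finset.mul_sum, Finset.sum_add_distrib, Finset.sum_const, Finset.card_univ,
          Fintype.card_fin, nsmul_eq_mul, mul_one, configEnergy]
        push_cast
        ring

/-- **Pathwise bound on the collision sum of collisional changes.** On a datum `z` in the good set of
Alexander's construction (diameter `hsDiameter σ N`), for every `t` and every velocity observable with
`|φ(v)| ≤ c(1 + |v|²)`, the sum over the counted collisions `m < collisionCount z t` of the `hit`-selected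
changes `φ(vᵢ') + φ(vⱼ') − φ(vᵢ) − φ(vⱼ)` is at most `2c((N+1) + Σᵢ|vᵢ|²)` in absolute value: it telescopes to
`Σᵢ φ(vᵢ(z_K)) − Σᵢ φ(vᵢ(z))` (`stub_velTelescope`; the counted flights are finite by
`collisionInstant_succ_le_of_mem_range`) and the kinetic energy is conserved (`configEnergy_stateAfter`).
[folklore] -/
theorem collisionDiffSum_abs_le_of_good {σ : ℝ} {N : ℕ} {c : ℝ} {φ : V3 → ℝ}
    (hφ : ∀ v, |φ v| ≤ c * (1 + ‖v‖ ^ 2)) {z : Config (N + 1) (Fin 3) T3}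
    (hz : z ∈ Alexander.good (Torus.geometry (Fin 3)) (hsDiameter σ N)) (t : ℝ) :
    |∑ m ∈ Finset.range (Alexander.collisionCount (Torus.geometry (Fin 3)) (hsDiameter σ N) z t),
        ∑ i : Fin (N + 1), ∑ j : Fin (N + 1),
          (let y := freeFlight (Torus.geometry (Fin 3))
              (Alexander.freeExitTime (Torus.geometry (Fin 3)) (hsDiameter σ N)
                (Alexander.stateAfter (Torus.geometry (Fin 3)) (hsDiameter σ N) z m)).toReal
              (Alexander.stateAfter (Torus.geometry (Fin 3)) (hsDiameter σ N) z m)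
           if i < j ∧ y ∈ contactSet (Torus.geometry (Fin 3)) (N + 1) (hsDiameter σ N) i j ∧
               IsIncoming (Torus.geometry (Fin 3)) y i j then
             φ ((collidePair (Torus.geometry (Fin 3)) i j y i).2) +
               φ ((collidePair (Torus.geometry (Fin 3)) i j y j).2) - φ ((y i).2) - φ ((y j).2)
           else 0)| ≤ 2 * c * (((N : ℝ) + 1) + ∑ i, ‖(z i).2‖ ^ 2) := by
  set G := Torus.geometry (Fin 3) with hG
  set e := hsDiameter σ N with he
  set K := Alexander.collisionCount G e z t with hKdef
  have hK : ∀ m < K, Alexander.freeExitTime G e (Alexander.stateAfter G e z m) ≠ ∞ := by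
    intro m hm
    have hle := collisionInstant_succ_le_of_mem_range e (Finset.mem_range.2 hm)
    have hne : Alexander.collisionInstant G e z (m + 1) ≠ ∞ := (hle.trans_lt ENNReal.ofReal_lt_top).ne
    exact Alexander.collisionInstant_ne_top_iff.1 hne m (Nat.lt_succ_self m)
  rw [← stub_velTelescope G e φ hz.2.2.1 hK]
  have h1 := abs_sum_phi_le hφ (Alexander.stateAfter G e z K)
  have h2 := abs_sum_phi_le hφ z
  rw [Alexander.configEnergy_stateAfter] at h1
  have hE : 2 * configEnergy z = ∑ i, ‖(z i).2‖ ^ 2 := by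
    rw [configEnergy]; ring
  calc |∑ i, φ ((Alexander.stateAfter G e z K i).2) - ∑ i, φ ((z i).2)|
      ≤ |∑ i, φ ((Alexander.stateAfter G e z K i).2)| + |∑ i, φ ((z i).2)| := abs_sub _ _
    _ ≤ c * (((N : ℝ) + 1) + 2 * configEnergy z) + c * (((N : ℝ) + 1) + 2 * configEnergy z) :=
        add_le_add h1 h2
    _ = 2 * c * (((N : ℝ) + 1) + ∑ i, ‖(z i).2‖ ^ 2) := by rw [← hE]; ring

/-- **Almost every datum of a local Gibbs law is good for Alexander's construction** at the diameter
`hsDiameter σ N ∈ (0, 1/2)` (`0 < σ < 1/2`): Alexander's theorem `torusFlow_ae_good_holds` (the complement of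
the good set is Liouville-null) and absolute continuity of the local Gibbs law
(`localGibbsLaw_absolutelyContinuous`). [folklore] -/
theorem ae_mem_alexanderGood_localGibbsLaw {σ : ℝ} (hσ : 0 < σ) (hσ2 : σ < 2⁻¹) (a₀ θ₀ : T3 → ℝ)
    (u₀ : T3 → V3) (N : ℕ) (Φ : HardSphereFlow (Torus.geometry (Fin 3)) (hsDiameter σ N) (N + 1)) :
    ∀ᵐ z ∂(localGibbsLaw σ a₀ u₀ θ₀ N Φ), z ∈ Alexander.good (Torus.geometry (Fin 3)) (hsDiameter σ N) := by
  have hεpos : 0 < hsDiameter σ N := hsDiameter_pos hσ N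
  have hεlt : hsDiameter σ N < 2⁻¹ := (hsDiameter_le hσ.le N).trans_lt hσ2
  have h0 : liouville (Torus.geometry (Fin 3)) (N + 1) (hsDiameter σ N)
      (Alexander.good (Torus.geometry (Fin 3)) (hsDiameter σ N))ᶜ = 0 :=
    Alexander.torusFlow_ae_good_holds hεpos hεlt (N + 1)
  have h1 : ∀ᵐ z ∂(liouville (Torus.geometry (Fin 3)) (N + 1) (hsDiameter σ N)),
      z ∈ Alexander.good (Torus.geometry (Fin 3)) (hsDiameter σ N) := ae_iff.2 h0
  exact (localGibbsLaw_absolutelyContinuous σ a₀ u₀ θ₀ N Φ).ae_le h1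

/-- **Uniform second velocity moment of the local Gibbs laws.** For continuous profiles `a₀, θ₀ > 0`, `u₀`
and `σ ≤ 1/2` there is `C₂ ≥ 0` such that for every `N` and every flow, `z ↦ Σᵢ |vᵢ|²` is `P_N`-integrable
with `∫ Σᵢ |vᵢ|² dP_N ≤ C₂ (N + 1)` (`exists_lintegral_sum_norm_sq_localGibbsLaw_le`). [folklore] -/
theorem exists_integrable_sum_norm_sq_localGibbsLaw {a₀ θ₀ : T3 → ℝ} {u₀ : T3 → V3} (ha : Continuous a₀)
    (hθ : Continuous θ₀) (hu : Continuous u₀) (ha0 : ∀ x, 0 < a₀ x) (hθ0 : ∀ x, 0 < θ₀ x) {σ : ℝ}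
    (hσ2 : σ ≤ 1 / 2) :
    ∃ C₂ : ℝ, 0 ≤ C₂ ∧ ∀ (N : ℕ) (Φ : HardSphereFlow (Torus.geometry (Fin 3)) (hsDiameter σ N) (N + 1)),
      Integrable (fun z : Config (N + 1) (Fin 3) T3 => ∑ i, ‖(z i).2‖ ^ 2) (localGibbsLaw σ a₀ u₀ θ₀ N Φ) ∧
        ∫ z, ∑ i, ‖(z i).2‖ ^ 2 ∂(localGibbsLaw σ a₀ u₀ θ₀ N Φ) ≤ C₂ * ((N : ℝ) + 1) := by
  obtain ⟨C₂, hC₂0, hC₂⟩ := exists_lintegral_sum_norm_sq_localGibbsLaw_le ha hθ hu ha0 hθ0 hσ2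
  refine ⟨C₂, hC₂0, fun N Φ => ?_⟩
  set μ := localGibbsLaw σ a₀ u₀ θ₀ N Φ with hμ
  set V : Config (N + 1) (Fin 3) T3 → ℝ := fun z => ∑ i, ‖(z i).2‖ ^ 2 with hV
  have hVm : Measurable V :=
    Finset.measurable_sum _ fun i _ => ((measurable_pi_apply i).snd.norm).pow_const 2
  have hV0 : ∀ z, 0 ≤ V z := fun z => Finset.sum_nonneg fun i _ => by positivity
  have hVlint : ∫⁻ z, ENNReal.ofReal (V z) ∂μ ≤ ENNReal.ofReal (C₂ * ((N : ℝ) + 1)) := hC₂ N Φ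
  have hVint : Integrable V μ :=
    ⟨hVm.aestronglyMeasurable,
      (hasFiniteIntegral_iff_ofReal (ae_of_all _ hV0)).2 (hVlint.trans_lt ENNReal.ofReal_lt_top)⟩
  refine ⟨hVint, ?_⟩
  rw [← ENNReal.ofReal_le_ofReal_iff (by positivity),
    ofReal_integral_eq_lintegral_ofReal hVint (ae_of_all _ hV0)]
  exact hVlint

/-- **The collision sum rule** (registered stub `stub_sumRule` of line `Sketch` v8). For continuous profiles
`a₀, θ₀ > 0`, `u₀`, every `0 < σ < 1/2`, every flow family `Φ`, every `t` and every `c ≥ 0`, velocity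
observables `φ_N` with `|φ_N(v)| ≤ c(1 + |v|²)` have
`|∫ (N+1)^{-4/3} Σ_{m < collisionCount z t} Σ_{i<j hit} Δφ_N dP_N| ≤ C (N+1)^{-1/3}` for all `N`, with
`C = 2c(1 + C₂)`, `C₂` the uniform second-moment constant of the local Gibbs laws. Almost every datum is
good (`ae_mem_alexanderGood_localGibbsLaw`); there the sum is bounded pathwise
(`collisionDiffSum_abs_le_of_good`); the bound is integrated with `norm_integral_le_of_norm_le` (no
measurability of the collision sum is needed) and `exists_integrable_sum_norm_sq_localGibbsLaw`. [folklore] -/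
theorem stub_sumRule :
    let Cfg : ℕ → Type := fun N => Config (N + 1) (Fin 3) T3
    let G := Torus.geometry (Fin 3)
    let ε : ℝ → ℕ → ℝ := hsDiameter
    let τ : ℝ → (N : ℕ) → Cfg N → ℝ≥0∞ := fun σ N z => Alexander.freeExitTime G (ε σ N) z
    let S : ℝ → (N : ℕ) → Cfg N → Cfg N := fun t _ z => freeFlight G t z
    let zpre : ℝ → (N : ℕ) → Cfg N → ℕ → Cfg N := fun σ N z m =>
      let y := Alexander.stateAfter G (ε σ N) z m; S (τ σ N y).toReal N y
    let Kt : ℝ → (N : ℕ) → Cfg N → ℝ → ℕ := fun σ N z t => Alexander.collisionCount G (ε σ N) z t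
    let hit : ℝ → (N : ℕ) → Cfg N → Fin (N + 1) → Fin (N + 1) → Prop := fun σ N y i j =>
      i < j ∧ y ∈ contactSet G (N + 1) (ε σ N) i j ∧ IsIncoming G y i j
    ∀ (a₀ θ₀ : T3 → ℝ) (u₀ : T3 → V3), Continuous a₀ → Continuous θ₀ → Continuous u₀ →
      (∀ x, 0 < a₀ x) → (∀ x, 0 < θ₀ x) → ∀ σ : ℝ, 0 < σ → σ < 2⁻¹ →
      ∀ Φ : (N : ℕ) → HardSphereFlow G (ε σ N) (N + 1),
      let P := fun N => localGibbsLaw σ a₀ u₀ θ₀ N (Φ N)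
      ∀ (t c : ℝ), 0 ≤ c → ∀ φ : ℕ → V3 → ℝ, (∀ N v, |φ N v| ≤ c * (1 + ‖v‖ ^ 2)) →
      ∃ C : ℝ, ∀ N : ℕ,
        |∫ z, ((N : ℝ) + 1) ^ (-(4 / 3 : ℝ)) * ∑ m ∈ Finset.range (Kt σ N z t),
            ∑ i : Fin (N + 1), ∑ j : Fin (N + 1),
              (let y := zpre σ N z m
               if hit σ N y i j then
                 φ N ((collidePair G i j y i).2) + φ N ((collidePair G i j y j).2) -
                   φ N ((y i).2) - φ N ((y j).2)
               else 0) ∂(P N)| ≤ C * ((N : ℝ) + 1) ^ (-(1 / 3 : ℝ)) := by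
  intro Cfg G ε τ S zpre Kt hit a₀ θ₀ u₀ ha hθ hu ha0 hθ0 σ hσ hσ2 Φ P t c hc φ hφ
  have hσ2' : σ ≤ 1 / 2 := by rw [one_div]; exact hσ2.le
  obtain ⟨C₂, hC₂0, hC₂⟩ := exists_integrable_sum_norm_sq_localGibbsLaw ha hθ hu ha0 hθ0 hσ2'
  refine ⟨2 * c * (1 + C₂), fun N => ?_⟩
  obtain ⟨hVint, hVle⟩ := hC₂ N (Φ N)
  have hPμ : IsProbabilityMeasure (P N) := isProbabilityMeasure_localGibbsLaw ha hθ hu ha0 hθ0 hσ2' N (Φ N)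
  set Nr : ℝ := (N : ℝ) + 1 with hNr
  have hNr0 : 0 < Nr := by positivity
  -- the dominating function
  set g : Cfg N → ℝ := fun z => Nr ^ (-(4 / 3 : ℝ)) * (2 * c * (Nr + ∑ i, ‖(z i).2‖ ^ 2)) with hg
  have hgint : Integrable g (P N) :=
    (((integrable_const Nr).add hVint).const_mul (2 * c)).const_mul _
  have hbound : ∀ᵐ z ∂(P N), ‖Nr ^ (-(4 / 3 : ℝ)) * ∑ m ∈ Finset.range (Kt σ N z t),
      ∑ i : Fin (N + 1), ∑ j : Fin (N + 1),
        (let y := zpre σ N z m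
         if hit σ N y i j then
           φ N ((collidePair G i j y i).2) + φ N ((collidePair G i j y j).2) -
             φ N ((y i).2) - φ N ((y j).2)
         else 0)‖ ≤ g z := by
    filter_upwards [ae_mem_alexanderGood_localGibbsLaw hσ hσ2 a₀ θ₀ u₀ N (Φ N)] with z hz
    rw [hg, Real.norm_eq_abs, abs_mul, abs_of_nonneg (by positivity : (0 : ℝ) ≤ Nr ^ (-(4 / 3 : ℝ)))]
    exact mul_le_mul_of_nonneg_left (collisionDiffSum_abs_le_of_good (hφ N) hz t) (by positivity)
  -- integrate
  have hint := norm_integral_le_of_norm_le hgint hbound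
  rw [Real.norm_eq_abs] at hint
  refine hint.trans ?_
  have hcst : ∫ _z, Nr ∂(P N) = Nr := by simp
  have hgI : ∫ z, g z ∂(P N) = Nr ^ (-(4 / 3 : ℝ)) * (2 * c * (Nr + ∫ z, ∑ i, ‖(z i).2‖ ^ 2 ∂(P N))) := by
    rw [hg, integral_const_mul, integral_const_mul, integral_add (integrable_const Nr) hVint, hcst]
  rw [hgI]
  have hpow : Nr ^ (-(4 / 3 : ℝ)) * Nr = Nr ^ (-(1 / 3 : ℝ)) := by
    rw [← Real.rpow_add_one hNr0.ne']
    norm_num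
  calc Nr ^ (-(4 / 3 : ℝ)) * (2 * c * (Nr + ∫ z, ∑ i, ‖(z i).2‖ ^ 2 ∂(P N)))
      ≤ Nr ^ (-(4 / 3 : ℝ)) * (2 * c * (Nr + C₂ * Nr)) := by gcongr
    _ = 2 * c * (1 + C₂) * (Nr ^ (-(4 / 3 : ℝ)) * Nr) := by ring
    _ = 2 * c * (1 + C₂) * Nr ^ (-(1 / 3 : ℝ)) := by rw [hpow]

end Summit.AtomisticToContinuum.HydrodynamicLimit.Theorems.ContactAngleEquidistributionSketch

end
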